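import Literature.Probability.RandomPlanarGeometry.SAWWidePolygons
import HarnessLib

/-!
# Traversals of a self-avoiding polygon: periodic injective readings, and «a traversal follows every sub-path»

Topic `Literature/Probability/RandomPlanarGeometry` (continues `SAWPolygonSurgery.lean` / `SAWWidePolygons.lean`; lane «pcv-sawmu», a-p4 g13).
These are the lattice-free lemmas of the DECODING step of Madras' join on the honeycomb lattice (LINE «HEX-MADRAS», design note E5a): the joined
polygon is read along ANY of its traversals, and the junction's arcs are recognised along the reading because a traversal that enters a sub-path of
the polygon must follow it to its end (every vertex of a polygon has exactly two polygon bonds).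

* `IsPolygon.eq_or_eq_of_mem` — degree two at every vertex of a polygon;
* `IsPolyTraversal G E L u` — `u : ℕ → V` reads the polygon `E`: `L`-periodic, injective on a period, consecutive sites span bonds of `E`, and every bond of
  `E` is read;
* `IsPolygon.exists_isPolyTraversal` — a polygon with `L` bonds has a traversal starting at any vertex `a` towards any polygon-neighbour `b` of `a`;
* **`IsPolyTraversal.follows_path`** — if `W : a ⇝ b` is a self-avoiding path with bonds in `E` and the traversal is at `a` at time `i` heading to
  `W`'s second vertex, then it reads `W` vertex by vertex: `u (i + k) = W.getVert k` for `k ≤ |W|`.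

Source frame: A. Hammond, arXiv:1504.05286v5, §4.2 pp. 20–24 (recognising the junction plaquette inside the joined polygon); N. Madras, G. Slade, *The
Self-Avoiding Walk* (1993), Definition 3.2.1 p. 62 (a polygon = the bonds of a closed self-avoiding walk; degree two).  Everything here is [folklore].

Consumers (LINE «HEX-MADRAS»): every junction-uniqueness bridge (`HexSAWPolygonJunctionUniqueT1/T2/T4/T3/T5.lean`) reads the joined
polygon along an `IsPolyTraversal` with `follows_path`, and `IsPolygon.exists_isPolyTraversal` supplies the traversal through the anchor bond.
ed.3 (a-p4 g14) = ed.2 eebdc0cadd74498a + this paragraph (no code change).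
-/

noncomputable section

open SimpleGraph

namespace Literature.Probability.RandomPlanarGeometry.SAW

section Generic

variable {V : Type*} {G : SimpleGraph V} [DecidableEq V]

/-- **A polygon has degree two at every vertex**: given two distinct polygon edges `v w₁`, `v w₂`, every polygon edge at `v` is one of them.
[cite: MadrasSlade1993, Definition 3.2.1 p. 62 (a self-avoiding polygon: every site has exactly two polygon bonds); folklore] -/
theorem IsPolygon.eq_or_eq_of_mem {E : Finset (Sym2 V)} (hE : IsPolygon G E) {v w₁ w₂ w : V}
    (h₁ : s(v, w₁) ∈ E) (h₂ : s(v, w₂) ∈ E) (h12 : w₁ ≠ w₂) (h : s(v, w) ∈ E) : w = w₁ ∨ w = w₂ := by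
  classical
  by_contra hw
  push Not at hw
  obtain ⟨u, c, hc, rfl⟩ := hE
  have hv : v ∈ c.support := c.fst_mem_support_of_mem_edges (List.mem_toFinset.1 h₁)
  have hN : (c.toSubgraph.neighborSet v).ncard = 2 := hc.ncard_neighborSet_toSubgraph_eq_two hv
  have hmem : ∀ {x}, s(v, x) ∈ c.edges.toFinset → x ∈ c.toSubgraph.neighborSet v := fun {x} hx => by
    rw [Subgraph.mem_neighborSet, ← Subgraph.mem_edgeSet, Walk.mem_edges_toSubgraph]
    exact List.mem_toFinset.1 hx
  have hsub : ({w₁, w₂, w} : Set V) ⊆ c.toSubgraph.neighborSet v := by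
    intro x hx
    simp only [Set.mem_insert_iff, Set.mem_singleton_iff] at hx
    rcases hx with rfl | rfl | rfl
    · exact hmem h₁
    · exact hmem h₂
    · exact hmem h
  have hfin : (c.toSubgraph.neighborSet v).Finite := Set.finite_of_ncard_pos (by rw [hN]; norm_num)
  have h3 : ({w₁, w₂, w} : Set V).ncard = 3 := by
    rw [Set.ncard_insert_of_notMem (by simp [h12, Ne.symm hw.1]) (Set.toFinite _),
      Set.ncard_pair (Ne.symm hw.2)]
  have := Set.ncard_le_ncard hsub hfin
  rw [h3, hN] at this
  omega

/-- **A traversal of the polygon `E`**: an `L`-periodic reading `u : ℕ → V`, injective on `[0, L)`, whose consecutive sites span bonds of `E` and which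
reads every bond of `E`. [cite: MadrasSlade1993, Definition 3.2.1 p. 62 (a polygon as a closed self-avoiding walk)] -/
structure IsPolyTraversal (G : SimpleGraph V) (E : Finset (Sym2 V)) (L : ℕ) (u : ℕ → V) : Prop where
  three_le : 3 ≤ L
  periodic : ∀ i, u (i + L) = u i
  inj : ∀ i j, i < L → j < L → u i = u j → i = j
  mem : ∀ i, s(u i, u (i + 1)) ∈ E
  adj : ∀ i, G.Adj (u i) (u (i + 1))
  surj : ∀ e ∈ E, ∃ i < L, s(u i, u (i + 1)) = e

namespace IsPolyTraversal

variable {E : Finset (Sym2 V)} {L : ℕ} {u : ℕ → V}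

omit [DecidableEq V] in
/-- Periodicity, iterated (bookkeeping for polygon traversals in the sense of
[cite: MadrasSlade1993, Definition 3.2.1 p. 62], used here). [folklore] -/
theorem periodic_mul (h : IsPolyTraversal G E L u) (i k : ℕ) : u (i + L * k) = u i := by
  induction k with
  | zero => simp
  | succ k ih => rw [Nat.mul_succ, ← add_assoc, h.periodic, ih]

omit [DecidableEq V] in
/-- Reduction modulo the period (bookkeeping for polygon traversals in the sense of
[cite: MadrasSlade1993, Definition 3.2.1 p. 62], used here). [folklore] -/
theorem apply_mod (h : IsPolyTraversal G E L u) (i : ℕ) : u (i % L) = u i := by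
  conv_rhs => rw [← Nat.mod_add_div i L]
  exact (h.periodic_mul (i % L) (i / L)).symm

omit [DecidableEq V] in
/-- Injectivity across two steps: `u (i + 2) ≠ u i` (`L ≥ 3`; bookkeeping for polygon
traversals in the sense of [cite: MadrasSlade1993, Definition 3.2.1 p. 62], used here).
[folklore] -/
theorem ne_succ_succ (h : IsPolyTraversal G E L u) (i : ℕ) : u (i + 2) ≠ u i := by
  intro he
  have hL := h.three_le
  have e1 : u ((i + 2) % L) = u (i % L) := by rw [h.apply_mod, h.apply_mod, he]
  have := h.inj _ _ (Nat.mod_lt _ (by omega)) (Nat.mod_lt _ (by omega)) e1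
  -- `(i+2) % L = i % L` is impossible for `L ≥ 3`
  have h2 : (i + 2) % L = (i % L + 2) % L := by rw [Nat.add_mod, Nat.mod_eq_of_lt (show 2 < L by omega)]
  rw [h2] at this
  by_cases hlt : i % L + 2 < L
  · rw [Nat.mod_eq_of_lt hlt] at this; omega
  · have hi : i % L < L := Nat.mod_lt _ (by omega)
    have : (i % L + 2) % L = i % L + 2 - L := by
      rw [Nat.mod_eq_sub_mod (by omega), Nat.mod_eq_of_lt (by omega)]
    omega

/-- **A traversal follows every sub-path of the polygon.**  If `W : a ⇝ b` is a self-avoiding path whose bonds lie in `E`, the traversal is at `a`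
at time `i` and at `W`'s second vertex at time `i + 1`, then `u (i + k) = W.getVert k` for all `k ≤ |W|` — at each vertex of a polygon there are
exactly two polygon bonds (`IsPolygon.eq_or_eq_of_mem`-type degree two, here in the form `IsPolygon.exists_two_edges`).
[cite: MadrasSlade1993, Definition 3.2.1 p. 62 (degree two); Hammond2015SAPJoining, §4.2 pp. 20–24 (arXiv v5: reading the junction inside the joined polygon)] -/
theorem follows_path (h : IsPolyTraversal G E L u) (hE : IsPolygon G E) {a b : V} (W : G.Walk a b) (hW : W.IsPath)
    (hWE : ∀ e ∈ W.edges, e ∈ E) {i : ℕ} (h0 : u i = a) (h1 : 1 ≤ W.length → u (i + 1) = W.getVert 1) :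
    ∀ k, k ≤ W.length → u (i + k) = W.getVert k := by
  intro k
  induction k using Nat.strong_induction_on with
  | _ k ih =>
    intro hk
    rcases Nat.lt_or_ge k 2 with hk2 | hk2
    · interval_cases k
      · simpa using h0
      · exact h1 hk
    · -- the polygon bonds at `w := W_{k-1} = u (i+k-1)` are `{W_{k-2}, W_{k-1}}` and `{W_{k-1}, W_k}`; the traversal's next site
      -- `u (i+k)` is a polygon neighbour of `w` other than `u (i+k-2) = W_{k-2}`, hence `W_k`
      have e1 : u (i + (k - 1)) = W.getVert (k - 1) := ih (k - 1) (by omega) (by omega)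
      have e2 : u (i + (k - 2)) = W.getVert (k - 2) := ih (k - 2) (by omega) (by omega)
      -- the two `W`-bonds at `W_{k-1}`
      have hb1 : s(W.getVert (k - 1), W.getVert (k - 2)) ∈ E := by
        rw [Sym2.eq_swap]
        have := hWE _ (W.adj_getVert_succ (i := k - 2) (by omega) |> fun _ =>
          (by
            have hmem : s(W.getVert (k - 2), W.getVert (k - 2 + 1)) ∈ W.edges := by
              have hlen : k - 2 < W.darts.length := by rw [SimpleGraph.Walk.length_darts]; omega
              have hd : W.darts[k - 2] ∈ W.darts := List.getElem_mem hlen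
              rw [SimpleGraph.Walk.darts_getElem_eq_getVert (k - 2) hlen] at hd
              exact List.mem_map.2 ⟨_, hd, rfl⟩
            exact hmem))
        rwa [show k - 2 + 1 = k - 1 by omega] at this
      have hb2 : s(W.getVert (k - 1), W.getVert k) ∈ E := by
        have hlen : k - 1 < W.darts.length := by rw [SimpleGraph.Walk.length_darts]; omega
        have hd : W.darts[k - 1] ∈ W.darts := List.getElem_mem hlen
        rw [SimpleGraph.Walk.darts_getElem_eq_getVert (k - 1) hlen] at hd
        have hmem : s(W.getVert (k - 1), W.getVert (k - 1 + 1)) ∈ W.edges := List.mem_map.2 ⟨_, hd, rfl⟩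
        rw [show k - 1 + 1 = k by omega] at hmem
        exact hWE _ hmem
      -- the traversal's bond at time `i + k - 1`
      have hb3 : s(W.getVert (k - 1), u (i + k)) ∈ E := by
        have := h.mem (i + (k - 1))
        rwa [e1, show i + (k - 1) + 1 = i + k by omega] at this
      -- distinctness: `W_{k-2} ≠ W_k` (path) and `u (i+k) ≠ W_{k-2} = u (i+k-2)` (traversal injective over two steps)
      have hne : W.getVert (k - 2) ≠ W.getVert k := by
        intro he
        have := (Walk.IsPath.getVert_injOn_iff W).2 hW (by simp only [Set.mem_setOf_eq]; omega) (by simp only [Set.mem_setOf_eq]; omega) he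
        omega
      have hne' : u (i + k) ≠ W.getVert (k - 2) := by
        rw [← e2, show i + k = i + (k - 2) + 2 by omega]
        exact h.ne_succ_succ _
      rcases hE.eq_or_eq_of_mem hb1 hb2 hne hb3 with h3 | h3
      · exact absurd h3 hne'
      · exact h3

end IsPolyTraversal

omit [DecidableEq V] in
/-- Consecutive vertices of a walk span one of its edges (private copy). [folklore] -/
private theorem getVert_succ_mem_edges'' {a b : V} (U : G.Walk a b) {k : ℕ} (hk : k < U.length) :
    s(U.getVert k, U.getVert (k + 1)) ∈ U.edges := by
  have hlen : k < U.darts.length := by rw [SimpleGraph.Walk.length_darts]; exact hk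
  have hd : U.darts[k] ∈ U.darts := List.getElem_mem hlen
  rw [SimpleGraph.Walk.darts_getElem_eq_getVert k hlen] at hd
  exact List.mem_map.2 ⟨_, hd, rfl⟩

/-- **Every polygon has a traversal through any bond, in either direction**: for `s(a, b) ∈ E` there is a traversal with `u 0 = a`, `u 1 = b` and
period `#E`. [cite: MadrasSlade1993, Definition 3.2.1 p. 62 and eq. (3.2.1) p. 63 (rooted oriented traversals of a polygon)] -/
theorem IsPolygon.exists_isPolyTraversal {E : Finset (Sym2 V)} (hE : IsPolygon G E) {a b : V} (hab : s(a, b) ∈ E) :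
    ∃ u : ℕ → V, IsPolyTraversal G E E.card u ∧ u 0 = a ∧ u 1 = b := by
  classical
  -- open the polygon at `ba`: a path `P : b ⇝ a` with the other bonds; the traversal reads `a, b = P_0, P_1, …, P_{L-1} = a, …` periodically
  have hba : s(b, a) ∈ E := by rw [Sym2.eq_swap]; exact hab
  obtain ⟨P, hP, hPe, hPno, hPl, hPs⟩ := hE.exists_isPath_erase hba
  set L := E.card with hL
  have hL3 : 3 ≤ L := by
    obtain ⟨w, c, hc, hcE⟩ := hE
    rw [hL, ← hcE, List.toFinset_card_of_nodup hc.edges_nodup, Walk.length_edges]; exact hc.three_le_length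
  have hPlen : P.length = L - 1 := by omega
  -- `u i := P.getVert ((i + L - 1) % L)` : `u 0 = P_{L-1} = a`, `u 1 = P_0 = b`, `u i = P_{i-1}`
  set u : ℕ → V := fun i => P.getVert ((i + (L - 1)) % L) with hu
  have hab' : G.Adj a b := by
    have := IsPolygon.mem_edgeSet hE hab
    exact this
  have u_of : ∀ i, 1 ≤ i → i ≤ L → u i = P.getVert (i - 1) := by
    intro i hi hiL
    show P.getVert ((i + (L - 1)) % L) = _
    rcases Nat.lt_or_ge i L with hlt | hge
    · rw [show i + (L - 1) = (i - 1) + L by omega, Nat.add_mod_right, Nat.mod_eq_of_lt (by omega)]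
    · have hiL' : i = L := by omega
      rw [hiL', show L + (L - 1) = (L - 1) + L by omega, Nat.add_mod_right, Nat.mod_eq_of_lt (by omega)]
  have u0 : u 0 = a := by
    show P.getVert ((0 + (L - 1)) % L) = a
    rw [Nat.zero_add, Nat.mod_eq_of_lt (by omega), ← hPlen, Walk.getVert_length]
  have uL : u L = a := by rw [u_of L (by omega) le_rfl, ← hPlen, Walk.getVert_length]
  have hper : ∀ i, u (i + L) = u i := fun i => by
    show P.getVert ((i + L + (L - 1)) % L) = P.getVert ((i + (L - 1)) % L)
    rw [show i + L + (L - 1) = (i + (L - 1)) + L by omega, Nat.add_mod_right]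
  refine ⟨u, ⟨hL3, hper, ?_, ?_, ?_, ?_⟩, u0, ?_⟩
  · -- injective on a period: `u 0 = a = P_{L-1}`, `u i = P_{i-1}` for `1 ≤ i < L`; `P` is a path
    intro i j hi hj hij
    have key : ∀ {i}, i < L → u i = P.getVert (if i = 0 then L - 1 else i - 1) := by
      intro i hi
      split_ifs with h0
      · rw [h0, u0, ← hPlen, Walk.getVert_length]
      · exact u_of i (by omega) hi.le
    rw [key hi, key hj] at hij
    have := (Walk.IsPath.getVert_injOn_iff P).2 hP (by simp only [Set.mem_setOf_eq]; split_ifs <;> omega)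
      (by simp only [Set.mem_setOf_eq]; split_ifs <;> omega) hij
    split_ifs at this <;> omega
  · -- consecutive sites span bonds of `E`
    intro i
    -- reduce to `i < L`
    have hred : ∀ i, i < L → s(u i, u (i + 1)) ∈ E := by
      intro i hi
      rcases Nat.eq_zero_or_pos i with rfl | hi0
      · rw [u0, Nat.zero_add, u_of 1 le_rfl (by omega), Walk.getVert_zero]; exact hab
      · rw [u_of i hi0 hi.le, u_of (i + 1) (by omega) (by omega), show i + 1 - 1 = i - 1 + 1 by omega]
        have hmem := getVert_succ_mem_edges'' P (k := i - 1) (by omega)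
        have : s(P.getVert (i - 1), P.getVert (i - 1 + 1)) ∈ E.erase s(b, a) := by rw [← hPe]; exact List.mem_toFinset.2 hmem
        exact (Finset.mem_erase.1 this).2
    have e0 : u i = u (i % L) := by
      conv_lhs => rw [← Nat.mod_add_div i L]
      clear hred
      induction i / L with
      | zero => simp
      | succ k ih => rw [Nat.mul_succ, ← add_assoc, hper, ih]
    have e1 : u (i + 1) = u (i % L + 1) := by
      have : i + 1 = (i % L + 1) + L * (i / L) := by have := Nat.mod_add_div i L; omega
      rw [this]
      clear hred e0 this
      induction i / L with
      | zero => simp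
      | succ k ih => rw [Nat.mul_succ, ← add_assoc, hper, ih]
    rw [e0, e1]
    exact hred _ (Nat.mod_lt _ (by omega))
  · -- adjacency
    intro i
    have hmem : ∀ j, s(u j, u (j + 1)) ∈ E := by
      -- same reduction as above
      intro j
      have hred : ∀ i, i < L → s(u i, u (i + 1)) ∈ E := by
        intro i hi
        rcases Nat.eq_zero_or_pos i with rfl | hi0
        · rw [u0, Nat.zero_add, u_of 1 le_rfl (by omega), Walk.getVert_zero]; exact hab
        · rw [u_of i hi0 hi.le, u_of (i + 1) (by omega) (by omega), show i + 1 - 1 = i - 1 + 1 by omega]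
          have hm := getVert_succ_mem_edges'' P (k := i - 1) (by omega)
          have : s(P.getVert (i - 1), P.getVert (i - 1 + 1)) ∈ E.erase s(b, a) := by rw [← hPe]; exact List.mem_toFinset.2 hm
          exact (Finset.mem_erase.1 this).2
      have e0 : u j = u (j % L) := by
        conv_lhs => rw [← Nat.mod_add_div j L]
        clear hred
        induction j / L with
        | zero => simp
        | succ k ih => rw [Nat.mul_succ, ← add_assoc, hper, ih]
      have e1 : u (j + 1) = u (j % L + 1) := by
        have : j + 1 = (j % L + 1) + L * (j / L) := by have := Nat.mod_add_div j L; omega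
        rw [this]
        clear hred e0 this
        induction j / L with
        | zero => simp
        | succ k ih => rw [Nat.mul_succ, ← add_assoc, hper, ih]
      rw [e0, e1]; exact hred _ (Nat.mod_lt _ (by omega))
    exact IsPolygon.mem_edgeSet hE (hmem i)
  · -- every bond is read
    intro e he
    by_cases hea : e = s(a, b)
    · exact ⟨0, by omega, by rw [u0, Nat.zero_add, u_of 1 le_rfl (by omega), Walk.getVert_zero, hea]⟩
    · have he' : e ∈ P.edges.toFinset := by rw [hPe, Finset.mem_erase, Sym2.eq_swap]; exact ⟨hea, he⟩
      rw [List.mem_toFinset] at he'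
      -- an edge of `P` is `s(P_k, P_{k+1})` for some `k < |P|`
      obtain ⟨d, hd, hde⟩ := List.mem_map.1 he'
      obtain ⟨k, hk, hdk⟩ := List.mem_iff_getElem.1 hd
      have hkl : k < P.length := by rw [← SimpleGraph.Walk.length_darts]; exact hk
      rw [SimpleGraph.Walk.darts_getElem_eq_getVert k hk] at hdk
      refine ⟨k + 1, by omega, ?_⟩
      rw [u_of (k + 1) (by omega) (by omega), u_of (k + 2) (by omega) (by omega), Nat.add_sub_cancel,
        show k + 2 - 1 = k + 1 by omega, ← hde, ← hdk]
      rfl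
  · rw [u_of 1 le_rfl (by omega), Nat.sub_self, Walk.getVert_zero]

end Generic

end Literature.Probability.RandomPlanarGeometry.SAW

end
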